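import Mathlib
import Literature.NumberTheory.LFunctions.RiemannXi
import Literature.Analysis.Complex.JensenPolynomialHyperbolicity
import Summits.RiemannHypothesis.RiemannHypothesis.Theorems.SoloBlindJensenShift

/-!
# Planting a zero pair, and monotonicity of Jensen hyperbolicity in the degree

Two pieces of exact bookkeeping on the axis `n = 0` of the Jensen–Pólya filtration
(`RiemannHypothesis ↔ ∀ d, J^{d,0}_γ` hyperbolic, `Literature.NumberTheory.LFunctions.polya_jensen`).

1. `soloBlind_jensenPoly_planted_eq` — PLANTING IDENTITY. If `G(x) = Σ γ(m) x^m / m!` and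
   `F(x) = (x² + b x + c) G(x) = Σ γ'(m) x^m / m!`, then `γ'(m) = c γ(m) + b m γ(m−1) + m(m−1) γ(m−2)` and
   `J^{d,0}_{γ'} = c · J^{d,0}_γ + b d · X · J^{d−1,0}_γ + d(d−1) · X² · J^{d−2,0}_γ`
   for every real sequence `γ` and every `d` (`ℕ`-truncated indices are harmless: their coefficients vanish).
   With `b = 2(γ₀² − η²)`, `c = (γ₀² + η²)²` this plants the conjugate pair `(η ± iγ₀)²` — the image of a
   quadruple `1/2 ± η ± iγ₀` of zeros off the critical line — into any background `G`; the case `G = eˣ`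
   is `soloBlind_jensenPoly_quadExp_eq`.
2. `soloBlind_jensenPoly_splits_of_succ` / `_of_le` — MONOTONICITY IN `d` AT SHIFT `0`: if `J^{d+1,0}_γ` is
   hyperbolic then so is `J^{d,0}_γ`; hence the set of hyperbolic degrees is an initial segment of `ℕ`.
   Mechanism (`soloBlind_derivative_reflect_jensenPoly`): the reversal `X^d J^{d,0}(1/X) = Σ (d choose k) γ(k) X^{d−k}`
   satisfies `(reversal of J^{d+1,0})' = (d+1) · (reversal of J^{d,0})`, and reflection (`splits_reflect`) and
   differentiation (`splits_derivative`, Rolle) preserve real-rootedness. (Craven–Csordas, Pacific J. Math. 136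
   (1989), §2, for Taylor sequences of polynomials; here for arbitrary real sequences.)

Use: (2) makes the detection threshold `d*(γ) = max {d : J^{d,0}_γ hyperbolic}` well defined and certifiable by a
single exact Sturm computation at `d* + 1`; (1) is the algebra behind the soloist's note on how late `J^{d,0}` sees a
zero off the line (the threshold is `x · (γ₀² + η²)²/(4γ₀²η²)` with `x ∈ [1, 3 + πη/s]` depending on the background).

Soloist artefact `solo-RiemannHypothesis-blind`, session 23 (2026-08-19). Mathlib + the tree's Jensen-polynomial
library + `SoloBlindJensenShift` (binomial bookkeeping lemmas); no sorries.
-/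

open Polynomial

namespace Summit.RiemannHypothesis.RiemannHypothesis.Theorems

open Literature.NumberTheory.LFunctions (jensenPoly)
open Literature.Analysis.Complex.PolyaSchur

/-- **Planting identity.** For every real sequence `γ` and all `b c : ℝ`, `d : ℕ`: the degree-`d`, shift-`0`
Jensen polynomial of the sequence `m ↦ c γ(m) + b m γ(m−1) + m(m−1) γ(m−2)` (the Taylor sequence of
`(x² + bx + c) · Σ γ(m) x^m/m!`) equals `c J^{d,0}_γ + b d X J^{d−1,0}_γ + d(d−1) X² J^{d−2,0}_γ`. [folklore] -/
theorem soloBlind_jensenPoly_planted_eq (b c : ℝ) (γ : ℕ → ℝ) (d : ℕ) :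
    jensenPoly (fun m : ℕ => c * γ m + b * m * γ (m - 1) + m * ((m : ℝ) - 1) * γ (m - 2)) d 0
      = C c * jensenPoly γ d 0 + C (b * d) * (X * jensenPoly γ (d - 1) 0)
        + C ((d : ℝ) * ((d : ℝ) - 1)) * (X ^ 2 * jensenPoly γ (d - 2) 0) := by
  rw [show (X : ℝ[X]) * jensenPoly γ (d - 1) 0 = X ^ 1 * jensenPoly γ (d - 1) 0 by rw [pow_one]]
  ext j
  have e1 := soloBlind_choose_aux₁ d j
  have e2 := soloBlind_choose_aux₂ d j
  simp only [coeff_jensenPoly, coeff_add, coeff_C_mul, coeff_X_pow_mul', zero_add]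
  by_cases hj : j ≤ d
  · have hj1 : j - 1 ≤ d - 1 := Nat.sub_le_sub_right hj 1
    have hj2 : j - 2 ≤ d - 2 := Nat.sub_le_sub_right hj 2
    simp only [if_pos hj, if_pos hj1, if_pos hj2]
    have f1 : (if 1 ≤ j then (((d - 1).choose (j - 1) : ℕ) : ℝ) * γ (j - 1) else 0)
        = (if 1 ≤ j then (((d - 1).choose (j - 1) : ℕ) : ℝ) else 0) * γ (j - 1) := by
      split_ifs <;> simp
    have f2 : (if 2 ≤ j then (((d - 2).choose (j - 2) : ℕ) : ℝ) * γ (j - 2) else 0)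
        = (if 2 ≤ j then (((d - 2).choose (j - 2) : ℕ) : ℝ) else 0) * γ (j - 2) := by
      split_ifs <;> simp
    rw [f1, f2]
    linear_combination (-(b * γ (j - 1))) * e1 - (γ (j - 2)) * e2
  · simp only [if_neg hj]
    rcases d with _ | _ | d
    · simp
    · have h1 : ¬ (j - 1 ≤ 0) := by omega
      simp [h1]
    · have h1 : ¬ (j - 1 ≤ d + 1) := by omega
      have h2 : ¬ (j - 2 ≤ d) := by omega
      simp [h1, h2]

/-- The reversal identity behind monotonicity: `d/dX [X^{d+1} J^{d+1,0}_γ(1/X)] = (d+1) · X^d J^{d,0}_γ(1/X)`,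
i.e. `(reflect (d+1) J^{d+1,0})' = (d+1) · reflect d J^{d,0}` (the identity `(d+1 choose k)(d+1−k) = (d+1)(d choose k)`).
[folklore] -/
theorem soloBlind_derivative_reflect_jensenPoly (γ : ℕ → ℝ) (d : ℕ) :
    derivative (reflect (d + 1) (jensenPoly γ (d + 1) 0))
      = C ((d : ℝ) + 1) * reflect d (jensenPoly γ d 0) := by
  ext i
  rw [coeff_derivative, coeff_reflect, coeff_C_mul, coeff_reflect, coeff_jensenPoly, coeff_jensenPoly]
  by_cases hi : i ≤ d
  · rw [revAt_le (by omega : i + 1 ≤ d + 1), revAt_le hi,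
      if_pos (by omega : d + 1 - (i + 1) ≤ d + 1), if_pos (Nat.sub_le d i),
      (by omega : d + 1 - (i + 1) = d - i), zero_add]
    have h := Nat.choose_mul_succ_eq d (d - i)
    rw [(by omega : d + 1 - (d - i) = i + 1)] at h
    have h' : ((d.choose (d - i) : ℕ) : ℝ) * ((d : ℝ) + 1)
        = (((d + 1).choose (d - i) : ℕ) : ℝ) * ((i : ℝ) + 1) := by
      exact_mod_cast h
    linear_combination (-(γ (d - i))) * h'
  · rw [revAt_eq_self_of_lt (by omega : d + 1 < i + 1), revAt_eq_self_of_lt (by omega : d < i),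
      if_neg (by omega : ¬ (i + 1 ≤ d + 1)), if_neg hi]
    simp

/-- **Monotonicity of hyperbolicity in the degree (shift `0`).** If `J^{d+1,0}_γ` has only real zeros, so does
`J^{d,0}_γ`: reflect, differentiate (Rolle), reflect back. [cite: CravenCsordas1989, §2] -/
theorem soloBlind_jensenPoly_splits_of_succ (γ : ℕ → ℝ) (d : ℕ)
    (h : (jensenPoly γ (d + 1) 0).Splits) : (jensenPoly γ d 0).Splits := by
  have h1 : (reflect (d + 1) (jensenPoly γ (d + 1) 0)).Splits :=
    splits_reflect h (natDegree_jensenPoly_le γ (d + 1) 0)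
  have h2 := splits_derivative h1
  rw [soloBlind_derivative_reflect_jensenPoly] at h2
  have h3 : (reflect d (jensenPoly γ d 0)).Splits := by
    by_cases h0 : reflect d (jensenPoly γ d 0) = 0
    · rw [h0]; exact Splits.zero
    · exact Splits.of_dvd h2 (mul_ne_zero (C_ne_zero.mpr (Nat.cast_add_one_pos d).ne') h0)
        (dvd_mul_left _ _)
  have h4 := splits_reflect h3
    (natDegree_reflect_le.trans (max_le le_rfl (natDegree_jensenPoly_le γ d 0)))
  rwa [reflect_reflect] at h4

/-- **The hyperbolic degrees form an initial segment.** If `J^{e,0}_γ` is hyperbolic and `d ≤ e` then `J^{d,0}_γ` is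
hyperbolic. So `{d : J^{d,0}_γ hyperbolic}` is `{0, …, d*}` or all of `ℕ`, and ONE non-hyperbolic degree certifies
all larger ones. [cite: CravenCsordas1989, §2] -/
theorem soloBlind_jensenPoly_splits_of_le (γ : ℕ → ℝ) {d e : ℕ} (hde : d ≤ e)
    (h : (jensenPoly γ e 0).Splits) : (jensenPoly γ d 0).Splits := by
  obtain ⟨k, rfl⟩ := Nat.exists_eq_add_of_le hde
  induction k with
  | zero => simpa using h
  | succ k ih => exact ih (Nat.le_add_right d k) (soloBlind_jensenPoly_splits_of_succ γ (d + k) h)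

/-- Contrapositive, the form used for certification: a non-hyperbolic `J^{d,0}_γ` makes every `J^{e,0}_γ`, `e ≥ d`,
non-hyperbolic. [folklore] -/
theorem soloBlind_jensenPoly_not_splits_of_le (γ : ℕ → ℝ) {d e : ℕ} (hde : d ≤ e)
    (h : ¬ (jensenPoly γ d 0).Splits) : ¬ (jensenPoly γ e 0).Splits :=
  fun he => h (soloBlind_jensenPoly_splits_of_le γ hde he)

end Summit.RiemannHypothesis.RiemannHypothesis.Theorems
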